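import Literature.AnabelianGeometry.SemiGraphs.TemperedMaximalCompactProofsAt
import Literature.AnabelianGeometry.SemiGraphs.TemperedEdgeLikeDistinctProofsAt
import Literature.AnabelianGeometry.SemiGraphs.TemperedEdgeLikeIncomparable
import HarnessLib

/-!
# [SemiAnbd] Thm 3.7 (iii)/(iv): nested edge-like subgroups are equal — PER-GRAPH twin (cell ruling φ2 / α4-3 (ii))

Mochizuki, *Semi-graphs of anabelioids*, Publ. RIMS **42** (2006), §3, Theorem 3.7 (ii)–(iv), manuscript
pp. 40–41 [cite: MochizukiSemiAnbd2006, Thm 3.7(iii)(iv) pp.40-41].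

PROOF-ONLY companion of `TemperedEdgeLikeIncomparable.lean` (abc-iut cell wave-4 seat abc-iut-w4-d075,
L3-lead ruling α4-3 (ii)
«φ2-CONSUMERS»): the same theorems with the ∀-countable named facts `CompactInVerticial` /
`MaximalCompactIffVerticial` / `EdgeLikeIsInfVerticial` / `EdgeLikeDistinct` replaced by their per-graph
forms `…At 𝒢` (`TemperedCompactInVerticialAt.lean`), so that the finite-`𝔾` producer
(`compactInVerticialAt_of_finiteLevelData`) feeds them; proofs ported VERBATIM with `hCV 𝒢 ↦ hCV`
(the `Thm37Hypotheses` argument stays).  Original file untouched.  No definitions, no new named fact;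
nothing here asserts Thm 3.7 (iii) for an infinite `𝔾`, and nothing bears on [IUTchIII] Cor. 3.12.
-/

namespace Literature.AnabelianGeometry.SemiGraphs

namespace ProfiniteSemiGraph

open Topology

universe u w

variable {𝒢 ℋ : ProfiniteSemiGraph.{u}}

/-- Two distinct members of the pair `{a, b}` have meet `a ⊓ b`. [folklore] -/
private theorem inf_eq_inf_of_mem_pair' {α : Type*} [SemilatticeInf α] {a b x y : α}
    (hx : x = a ∨ x = b) (hy : y = a ∨ y = b) (hxy : x ≠ y) : x ⊓ y = a ⊓ b := by
  rcases hx with rfl | rfl <;> rcases hy with rfl | rfl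
  · exact absurd rfl hxy
  · rfl
  · exact inf_comm _ _
  · exact absurd rfl hxy

/-- **Nested edge-like subgroups of `π₁^temp(𝒢)` are equal** (Thm 3.7 (iii) "precisely two … whose
intersection", (iv); cf. the commensurable terminality of edge-like subgroups): if `L ≤ L'` with `L`
edge-like of `e` and `L'` edge-like of `e'`, then `L = L'`. Edge-like subgroups of distinct edges meet
trivially and are infinite, so `e = e'`; write `L = g·φ_u(Π_b)·g⁻¹`, `L' = g'·φ_u(Π_b)·g'⁻¹` for one branch `b`
of `e` at `u`; if the hosts `g·φ_u(Π_u)·g⁻¹`, `g'·φ_u(Π_u)·g'⁻¹` coincide, `L' = L` by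
`map_branch_eq_of_le_of_hosts_eq`; if they are distinct hosts `H ≠ H'` of the compact nontrivial `L`, then
`e` is closed, `L ⊆` only these two verticial subgroups, and both `L` and `L'` are `H ⊓ H'`
(`edgeLikeIsInfVerticial_of`). [cite: MochizukiSemiAnbd2006, Thm 3.7(iii)(iv) p.41] -/
theorem eq_of_le_of_mem_edgeLikeSubgroups_at (hCV : CompactInVerticialAt 𝒢) (hVD : VerticialDistinct.{u})
    (hVI : VerticialInjective.{u}) (h𝒢 : 𝒢.Thm37Hypotheses) (c : TemperedPiChart 𝒢)
    {e e' : 𝒢.graph.Edge} {L L' : Subgroup c.G} (hL : L ∈ edgeLikeSubgroups c e)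
    (hL' : L' ∈ edgeLikeSubgroups c e') (hle : L ≤ L') : L = L' := by
  classical
  haveI := TemperedPiChart.t2Space c
  have hLne : L ≠ ⊥ := ne_bot_of_mem_edgeLikeSubgroups hVI h𝒢 c hL
  -- the edges coincide
  have hee : e' = e := by
    by_contra hne
    have hbot := edgeLike_inf_edgeLike_eq_bot_at hCV hVD hVI h𝒢 c (fun h => hne h.symm) hL hL'
    rw [inf_eq_left.mpr hle] at hbot
    exact hLne hbot
  subst hee
  -- one branch `b` of the edge, abutting to `u`, and verticial homomorphisms everywhere
  obtain ⟨w⟩ := h𝒢.hasVertex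
  obtain ⟨b, hbe, hs⟩ := SemiGraph.exists_abuts_of_isConnected h𝒢.isConnected w e'
  obtain ⟨u, hb⟩ := Option.isSome_iff_exists.mp hs
  subst hbe
  have hΦ' : ∀ v : 𝒢.graph.Vertex, ∃ φ : 𝒢.Gv v →ₜ* c.G, IsVerticialHom c v φ := by
    intro v
    obtain ⟨-, φ, hφ, -⟩ := (hVI 𝒢 h𝒢 c v).1
    exact ⟨φ, hφ⟩
  choose Φ hΦ using hΦ'
  obtain ⟨g, hLg⟩ := edgeLike_eq_map_branchSubgroup c hb hL (Φ u) (hΦ u)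
  obtain ⟨g', hL'g⟩ := edgeLike_eq_map_branchSubgroup c hb hL' (Φ u) (hΦ u)
  -- the two hosts
  have hH : (Φ u).toMonoidHom.range.map (MulAut.conj g).toMonoidHom ∈ verticialSubgroups c u :=
    conj_mem_verticialSubgroups c (range_mem_verticialSubgroups c (Φ u) (hΦ u)) g
  have hH' : (Φ u).toMonoidHom.range.map (MulAut.conj g').toMonoidHom ∈ verticialSubgroups c u :=
    conj_mem_verticialSubgroups c (range_mem_verticialSubgroups c (Φ u) (hΦ u)) g'
  have hLH : L ≤ (Φ u).toMonoidHom.range.map (MulAut.conj g).toMonoidHom := by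
    rw [hLg]
    exact Subgroup.map_mono (Subgroup.map_le_range _ _)
  have hL'H' : L' ≤ (Φ u).toMonoidHom.range.map (MulAut.conj g').toMonoidHom := by
    rw [hL'g]
    exact Subgroup.map_mono (Subgroup.map_le_range _ _)
  by_cases hHH : (Φ u).toMonoidHom.range.map (MulAut.conj g).toMonoidHom =
      (Φ u).toMonoidHom.range.map (MulAut.conj g').toMonoidHom
  · -- equal hosts: rigidity of the branch image in its host
    have hne' : ((𝒢.branchSubgroup b u hb).map (Φ u).toMonoidHom).map (MulAut.conj g).toMonoidHom ≠ ⊥ := by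
      rw [← hLg]; exact hLne
    have hle' : ((𝒢.branchSubgroup b u hb).map (Φ u).toMonoidHom).map (MulAut.conj g).toMonoidHom ≤
        ((𝒢.branchSubgroup b u hb).map (Φ u).toMonoidHom).map (MulAut.conj g').toMonoidHom := by
      rw [← hLg, ← hL'g]; exact hle
    have h := map_branch_eq_of_le_of_hosts_eq hVD hVI h𝒢 c Φ hΦ hb hb g g' hne' hle' hHH
    rw [hLg, hL'g]
    exact h.symm
  · -- distinct hosts: `L` lies in precisely these two verticial subgroups, and the edge is closed
    obtain ⟨-, h2⟩ := hCV h𝒢 c L (isCompact_of_mem_edgeLikeSubgroups c hL)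
    obtain ⟨honly, e₁, L₁, he₁, hL₁, hLL₁⟩ := h2 hLne u u _ _ hH hH' hHH hLH (hle.trans hL'H')
    have he₁' : e₁ = 𝒢.graph.edgeOf b := by
      by_contra hne1
      have hbot := edgeLike_inf_edgeLike_eq_bot_at hCV hVD hVI h𝒢 c (fun h => hne1 h.symm) hL hL₁
      rw [inf_eq_left.mpr hLL₁] at hbot
      exact hLne hbot
    subst he₁'
    have hEI := edgeLikeIsInfVerticialAt_of hCV hVD hVI h𝒢 c (𝒢.graph.edgeOf b) he₁
    have hL'ne : L' ≠ ⊥ := fun h => hLne (le_bot_iff.mp (h ▸ hle))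
    obtain ⟨v₁, v₂, K₁, K₂, hK₁, hK₂, hK12, hL'eq⟩ := hEI L' hL' hL'ne
    obtain ⟨w₁, w₂, M₁, M₂, hM₁, hM₂, hM12, hLeq⟩ := hEI L hL hLne
    have hLK₁ : L ≤ K₁ := hle.trans (by rw [hL'eq]; exact inf_le_left)
    have hLK₂ : L ≤ K₂ := hle.trans (by rw [hL'eq]; exact inf_le_right)
    have hLM₁ : L ≤ M₁ := by rw [hLeq]; exact inf_le_left
    have hLM₂ : L ≤ M₂ := by rw [hLeq]; exact inf_le_right
    rw [hLeq, hL'eq, inf_eq_inf_of_mem_pair' (honly w₁ M₁ hM₁ hLM₁) (honly w₂ M₂ hM₂ hLM₂) hM12,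
      inf_eq_inf_of_mem_pair' (honly v₁ K₁ hK₁ hLK₁) (honly v₂ K₂ hK₂ hLK₂) hK12]

section Transport

variable {Gtp : Type w} [Group Gtp] (c : TemperedPiChart 𝒢) (ι : c.G →* Gtp)

/-- **hgeom_E**: nested images of edge-like subgroups under an injective `ι` are equal
(`eq_of_le_of_mem_edgeLikeSubgroups`, transported). [cite: MochizukiSemiAnbd2006, Thm 3.7(iv) p.41] -/
theorem map_edgeLike_eq_of_le_at (hCV : CompactInVerticialAt 𝒢) (hVD : VerticialDistinct.{u})
    (hVI : VerticialInjective.{u}) (h𝒢 : 𝒢.Thm37Hypotheses) (hι : Function.Injective ι)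
    {L L' : Subgroup Gtp} (hL : ∃ e : 𝒢.graph.Edge, ∃ K ∈ edgeLikeSubgroups c e, L = K.map ι)
    (hL' : ∃ e : 𝒢.graph.Edge, ∃ K ∈ edgeLikeSubgroups c e, L' = K.map ι) (hle : L ≤ L') :
    L = L' := by
  obtain ⟨e, K, hK, rfl⟩ := hL
  obtain ⟨e', K', hK', rfl⟩ := hL'
  rw [eq_of_le_of_mem_edgeLikeSubgroups_at hCV hVD hVI h𝒢 c hK hK'
    ((Subgroup.map_le_map_iff_of_injective hι).mp hle)]

end Transport

end ProfiniteSemiGraph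

end Literature.AnabelianGeometry.SemiGraphs
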